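import Summits.AtomisticToContinuum.HydrodynamicLimit.Theorems.OneFlightGossipEngineSuperExponentialEnergyTailsDefs
import Literature.MathematicalPhysics.KineticTheory.HardSphereEulerProofs
import Literature.Analysis.FunctionSpaces.TorusSpaceTime
import HarnessLib

/-!
# Stub T2 (ungauging) of line `Sketch`, crux `SuperExponentialEnergyTails`
# (stmt-AtomisticToContinuum-17701)

`GaugedMomentHierarchy → VelocityMomentHierarchy`: the `k`-wise moment hierarchy for the
Euler-gauged energies `êᵢ = ‖vᵢ − u(s,xᵢ)‖² / θ(s,xᵢ)` under the true pre-shock law transfers to the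
plain velocity moment hierarchy.  On the compact slab `[0,t] × 𝕋³` (`t < T`) the classical Euler
solution has `θ ≤ Θ̄` and `‖u‖ ≤ U` (`IsSmoothSpaceTimeOn.exists_norm_le_of_isCompact`), so
pointwise `‖v‖² ≤ 2Θ̄ ê + 2U²` and `(‖v‖²)ᵏ ≤ (4Θ̄)ᵏ êᵏ + (4U²)ᵏ`; since the local Gibbs laws are
probability measures for `σ ≤ 1/2` (`isProbabilityMeasure_localGibbsLaw`), the hierarchy
transfers with `(A, C) ↦ (4Θ̄A + 4U², C + 1)` and the same threshold `N₀(k)`; the density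
threshold becomes `min σ₀ (1/2)`.

Support file (`--supports stmt-AtomisticToContinuum-17701`) of the registered skeleton
`Cruxes/SuperExponentialEnergyTails/Lines/Sketch.lean`.
-/

noncomputable section

namespace Summit.AtomisticToContinuum.HydrodynamicLimit.Theorems.SuperExponentialEnergyTailsVelocityOfGauged

open scoped BigOperators ENNReal
open MeasureTheory Set
open Literature.MathematicalPhysics.KineticTheory Literature.Analysis.FluidPDE
open Literature.Analysis.FunctionSpaces
open Summit.AtomisticToContinuum.HydrodynamicLimit.Theorems.SuperExponentialEnergyTailsLine
  (VelocityMomentHierarchy GaugedMomentHierarchy)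

/-! ## Elementary inequalities -/

/-- `(p + q)ᵏ ≤ (2p)ᵏ + (2q)ᵏ` for `p, q ≥ 0` (through `p + q ≤ 2 max p q`). -/
theorem add_pow_le_two_mul_pow_add {p q : ℝ} (hp : 0 ≤ p) (hq : 0 ≤ q) (k : ℕ) :
    (p + q) ^ k ≤ (2 * p) ^ k + (2 * q) ^ k := by
  rcases le_total p q with h | h
  · calc (p + q) ^ k ≤ (2 * q) ^ k := pow_le_pow_left₀ (by positivity) (by linarith) k
      _ ≤ (2 * p) ^ k + (2 * q) ^ k := le_add_of_nonneg_left (by positivity)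
  · calc (p + q) ^ k ≤ (2 * p) ^ k := pow_le_pow_left₀ (by positivity) (by linarith) k
      _ ≤ (2 * p) ^ k + (2 * q) ^ k := le_add_of_nonneg_right (by positivity)

/-- **Ungauging one particle.**  If `0 < θ ≤ Θ` and `‖u‖ ≤ U` then
`(‖v‖²)ᵏ ≤ (4Θ)ᵏ (‖v − u‖²/θ)ᵏ + (4U²)ᵏ`. -/
theorem pow_norm_sq_le_gauged (v u : V3) {θ Θ U : ℝ} (hθ : 0 < θ) (hθΘ : θ ≤ Θ) (hu : ‖u‖ ≤ U)
    (k : ℕ) : (‖v‖ ^ 2) ^ k ≤ (4 * Θ) ^ k * (‖v - u‖ ^ 2 / θ) ^ k + (4 * U ^ 2) ^ k := by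
  have he0 : 0 ≤ ‖v - u‖ ^ 2 / θ := div_nonneg (sq_nonneg _) hθ.le
  have hsq : ‖v - u‖ ^ 2 = θ * (‖v - u‖ ^ 2 / θ) := by
    rw [mul_div_cancel₀ _ hθ.ne']
  have hΘ0 : 0 ≤ Θ := hθ.le.trans hθΘ
  have hU0 : 0 ≤ U := (norm_nonneg u).trans hu
  have h1 : ‖v‖ ≤ ‖v - u‖ + U :=
    calc ‖v‖ = ‖(v - u) + u‖ := by rw [sub_add_cancel]
      _ ≤ ‖v - u‖ + ‖u‖ := norm_add_le _ _
      _ ≤ ‖v - u‖ + U := by linarith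
  have h2 : ‖v‖ ^ 2 ≤ 2 * Θ * (‖v - u‖ ^ 2 / θ) + 2 * U ^ 2 :=
    calc ‖v‖ ^ 2 ≤ (‖v - u‖ + U) ^ 2 := pow_le_pow_left₀ (norm_nonneg v) h1 2
      _ ≤ 2 * ‖v - u‖ ^ 2 + 2 * U ^ 2 := by nlinarith [sq_nonneg (‖v - u‖ - U)]
      _ = 2 * (θ * (‖v - u‖ ^ 2 / θ)) + 2 * U ^ 2 := by rw [← hsq]
      _ ≤ 2 * (Θ * (‖v - u‖ ^ 2 / θ)) + 2 * U ^ 2 := by gcongr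
      _ = 2 * Θ * (‖v - u‖ ^ 2 / θ) + 2 * U ^ 2 := by ring
  calc (‖v‖ ^ 2) ^ k ≤ (2 * Θ * (‖v - u‖ ^ 2 / θ) + 2 * U ^ 2) ^ k :=
        pow_le_pow_left₀ (sq_nonneg _) h2 k
    _ ≤ (2 * (2 * Θ * (‖v - u‖ ^ 2 / θ))) ^ k + (2 * (2 * U ^ 2)) ^ k :=
        add_pow_le_two_mul_pow_add (by positivity) (by positivity) k
    _ = (4 * Θ) ^ k * (‖v - u‖ ^ 2 / θ) ^ k + (4 * U ^ 2) ^ k := by ring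

/-- **Averaging an affine pointwise bound**: `fᵢ ≤ a gᵢ + b` for all `i` gives
`(n+1)⁻¹ ∑ fᵢ ≤ a · (n+1)⁻¹ ∑ gᵢ + b`. -/
theorem avg_le_of_le {n : ℕ} (f g : Fin (n + 1) → ℝ) {a b : ℝ} (h : ∀ i, f i ≤ a * g i + b) :
    ((n : ℝ) + 1)⁻¹ * ∑ i, f i ≤ a * (((n : ℝ) + 1)⁻¹ * ∑ i, g i) + b := by
  have hn : (0 : ℝ) < (n : ℝ) + 1 := by positivity
  have hs : ∑ i, f i ≤ a * ∑ i, g i + ((n : ℝ) + 1) * b :=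
    calc ∑ i, f i ≤ ∑ i, (a * g i + b) := Finset.sum_le_sum fun i _ => h i
      _ = a * ∑ i, g i + ((n : ℝ) + 1) * b := by
        rw [Finset.sum_add_distrib, Finset.mul_sum, Finset.sum_const, Finset.card_univ,
          Fintype.card_fin, nsmul_eq_mul]
        push_cast
        ring
  calc ((n : ℝ) + 1)⁻¹ * ∑ i, f i ≤ ((n : ℝ) + 1)⁻¹ * (a * ∑ i, g i + ((n : ℝ) + 1) * b) :=
        mul_le_mul_of_nonneg_left hs (inv_nonneg.2 hn.le)
    _ = a * (((n : ℝ) + 1)⁻¹ * ∑ i, g i) + b := by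
        rw [mul_add, ← mul_assoc _ _ b, inv_mul_cancel₀ hn.ne', one_mul]
        ring

/-- **Integrating an affine pointwise bound against a probability measure** (in `ℝ≥0∞`, through
`ENNReal.ofReal`): `F ≤ a G + b` pointwise and `∫ G ≤ B` give `∫ F ≤ a B + b`. -/
theorem lintegral_ofReal_le_of_affine {Ω : Type*} [MeasurableSpace Ω] (μ : Measure Ω)
    [IsProbabilityMeasure μ] {F G : Ω → ℝ} {a b B : ℝ} (ha : 0 ≤ a) (hb : 0 ≤ b) (hB : 0 ≤ B)
    (hFG : ∀ z, F z ≤ a * G z + b) (hG : ∫⁻ z, ENNReal.ofReal (G z) ∂μ ≤ ENNReal.ofReal B) :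
    ∫⁻ z, ENNReal.ofReal (F z) ∂μ ≤ ENNReal.ofReal (a * B + b) := by
  calc ∫⁻ z, ENNReal.ofReal (F z) ∂μ
      ≤ ∫⁻ z, (ENNReal.ofReal a * ENNReal.ofReal (G z) + ENNReal.ofReal b) ∂μ := by
        refine lintegral_mono fun z => ?_
        calc ENNReal.ofReal (F z) ≤ ENNReal.ofReal (a * G z + b) := ENNReal.ofReal_le_ofReal (hFG z)
          _ ≤ ENNReal.ofReal (a * G z) + ENNReal.ofReal b := ENNReal.ofReal_add_le
          _ = ENNReal.ofReal a * ENNReal.ofReal (G z) + ENNReal.ofReal b := by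
              rw [ENNReal.ofReal_mul ha]
    _ = ENNReal.ofReal a * ∫⁻ z, ENNReal.ofReal (G z) ∂μ + ENNReal.ofReal b := by
        rw [lintegral_add_right _ measurable_const, lintegral_const_mul' _ _ ENNReal.ofReal_ne_top,
          lintegral_const, measure_univ, mul_one]
    _ ≤ ENNReal.ofReal a * ENNReal.ofReal B + ENNReal.ofReal b := by gcongr
    _ = ENNReal.ofReal (a * B + b) := by
        rw [ENNReal.ofReal_add (mul_nonneg ha hB) hb, ENNReal.ofReal_mul ha]

/-- **The transferred constants**: `(4Θ)ᵏ · (C Aᵏ k!) + (4U²)ᵏ ≤ (C + 1) (4ΘA + 4U²)ᵏ k!`. -/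
theorem gauged_consts_le {Θ U A C : ℝ} (hΘ : 0 ≤ Θ) (hA : 0 ≤ A) (hC : 0 ≤ C) (k : ℕ) :
    (4 * Θ) ^ k * (C * A ^ k * (k.factorial : ℝ)) + (4 * U ^ 2) ^ k ≤
      (C + 1) * (4 * Θ * A + 4 * U ^ 2) ^ k * (k.factorial : ℝ) := by
  have h1 : (4 * Θ) ^ k * A ^ k ≤ (4 * Θ * A + 4 * U ^ 2) ^ k := by
    rw [← mul_pow]
    exact pow_le_pow_left₀ (by positivity) (by nlinarith [sq_nonneg U]) k
  have h2 : (4 * U ^ 2) ^ k ≤ (4 * Θ * A + 4 * U ^ 2) ^ k :=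
    pow_le_pow_left₀ (by positivity) (by nlinarith [mul_nonneg hΘ hA]) k
  have hk : (1 : ℝ) ≤ (k.factorial : ℝ) := by exact_mod_cast Nat.succ_le_of_lt (Nat.factorial_pos k)
  have h3 : (4 * U ^ 2) ^ k ≤ (4 * Θ * A + 4 * U ^ 2) ^ k * (k.factorial : ℝ) :=
    h2.trans (le_mul_of_one_le_right (by positivity) hk)
  have h4 : C * ((4 * Θ) ^ k * A ^ k) * (k.factorial : ℝ) ≤
      C * (4 * Θ * A + 4 * U ^ 2) ^ k * (k.factorial : ℝ) :=
    mul_le_mul_of_nonneg_right (mul_le_mul_of_nonneg_left h1 hC) (by positivity)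
  calc (4 * Θ) ^ k * (C * A ^ k * (k.factorial : ℝ)) + (4 * U ^ 2) ^ k
      = C * ((4 * Θ) ^ k * A ^ k) * (k.factorial : ℝ) + (4 * U ^ 2) ^ k := by ring
    _ ≤ C * (4 * Θ * A + 4 * U ^ 2) ^ k * (k.factorial : ℝ) +
          (4 * Θ * A + 4 * U ^ 2) ^ k * (k.factorial : ℝ) := add_le_add h4 h3
    _ = (C + 1) * (4 * Θ * A + 4 * U ^ 2) ^ k * (k.factorial : ℝ) := by ring

/-! ## The stub -/

/-- **Stub T2 — ungauging.**  `GaugedMomentHierarchy → VelocityMomentHierarchy`: on `[0,t] × 𝕋³`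
(`t < T`) the classical solution has `θ ≤ Θ̄` and `‖u‖ ≤ U`
(`IsSmoothSpaceTimeOn.exists_norm_le_of_isCompact`), so `‖v‖² ≤ 2Θ̄ ê + 2U²` and
`(‖v‖²)ᵏ ≤ (4Θ̄)ᵏ êᵏ + (4U²)ᵏ`; with `λ^N(univ) = 1` (`isProbabilityMeasure_localGibbsLaw`,
`σ ≤ 1/2`, whence the threshold `min σ₀ (1/2)`) the hierarchy transfers with
`A' = 4Θ̄A + 4U²`, `C' = C + 1` and the same `N₀(k)`. -/
theorem stub_velocityOfGaugedHierarchy : GaugedMomentHierarchy → VelocityMomentHierarchy := by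
  intro hG a₀ θ₀ u₀ ha hθ hu ha0 hθ0
  obtain ⟨σ₀, hσ₀, H⟩ := hG a₀ θ₀ u₀ ha hθ hu ha0 hθ0
  refine ⟨min σ₀ (1 / 2), lt_min hσ₀ (by norm_num), fun σ hσ hσ' T ρ θ u hE Φ hLLN t ht => ?_⟩
  have hσ1 : σ < σ₀ := lt_of_lt_of_le hσ' (min_le_left _ _)
  have hσ2 : σ ≤ 1 / 2 := (lt_of_lt_of_le hσ' (min_le_right _ _)).le
  obtain ⟨A, hA, C, hC, Hk⟩ := H σ hσ hσ1 T ρ θ u hE Φ hLLN t ht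
  -- pre-shock bounds on the compact slab `[0, t] ⊆ [0, T)`
  have hsub : Icc 0 t ⊆ Ico 0 T := fun s hs => ⟨hs.1, lt_of_le_of_lt hs.2 ht.2⟩
  obtain ⟨Θ, hΘ1, hθle⟩ : ∃ Θ : ℝ, 1 ≤ Θ ∧ ∀ s ∈ Icc 0 t, ∀ x, θ s x ≤ Θ := by
    obtain ⟨Θb, hΘb⟩ := hE.smooth_temperature.exists_norm_le_of_isCompact isCompact_Icc hsub
    refine ⟨max Θb 1, le_max_right _ _, fun s hs x => ?_⟩
    have h := hΘb s hs x
    rw [Real.norm_eq_abs] at h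
    exact (le_abs_self _).trans (h.trans (le_max_left _ _))
  obtain ⟨U, hU0, hule⟩ : ∃ U : ℝ, 0 ≤ U ∧ ∀ s ∈ Icc 0 t, ∀ x, ‖u s x‖ ≤ U := by
    obtain ⟨Ub, hUb⟩ := hE.smooth_velocity.exists_norm_le_of_isCompact isCompact_Icc hsub
    exact ⟨max Ub 0, le_max_right _ _, fun s hs x => (hUb s hs x).trans (le_max_left _ _)⟩
  have hΘ0 : 0 < Θ := lt_of_lt_of_le one_pos hΘ1
  refine ⟨4 * Θ * A + 4 * U ^ 2, by positivity, C + 1, by linarith, fun k => ?_⟩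
  obtain ⟨N₀, hN₀⟩ := Hk k
  refine ⟨N₀, fun N hN s hs => ?_⟩
  have hθpos : ∀ x, 0 < θ s x := fun x => hE.temperature_pos s (hsub hs) x
  haveI := isProbabilityMeasure_localGibbsLaw ha hθ hu ha0 hθ0 hσ2 N (Φ N)
  have hpt : ∀ z : Config (N + 1) (Fin 3) T3,
      ((N : ℝ) + 1)⁻¹ * ∑ i : Fin (N + 1), (‖((Φ N).flow s z i).2‖ ^ 2) ^ k ≤
        (4 * Θ) ^ k * (((N : ℝ) + 1)⁻¹ * ∑ i : Fin (N + 1),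
          (‖((Φ N).flow s z i).2 - u s ((Φ N).flow s z i).1‖ ^ 2 /
            θ s ((Φ N).flow s z i).1) ^ k) + (4 * U ^ 2) ^ k :=
    fun z => avg_le_of_le _ _ fun i =>
      pow_norm_sq_le_gauged _ _ (hθpos _) (hθle s hs _) (hule s hs _) k
  exact (lintegral_ofReal_le_of_affine _ (by positivity) (by positivity) (by positivity) hpt
    (hN₀ N hN s hs)).trans (ENNReal.ofReal_le_ofReal (gauged_consts_le hΘ0.le hA.le hC.le k))

end Summit.AtomisticToContinuum.HydrodynamicLimit.Theorems.SuperExponentialEnergyTailsVelocityOfGauged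

end
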